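import Summits.SmoothPoincare4.SmoothPoincare4.Theorems.CylinderEntropyCylinderRungTwoKillingFluxDefs
import Summits.SmoothPoincare4.SmoothPoincare4.Theorems.CylinderEntropyCylinderRungTwoFluxIdentity
import Literature.Geometry.Riemannian.SphericalCylinderEntropy
import HarnessLib

/-!
# Route `CylinderEntropy`, crux `CylinderRungTwo` (stmt-SmoothPoincare4-7631), line `killing-flux`:
# the tilt gap `EpsilonRegularity → VerticalGap` (registered stub `stub_tiltGap`)

Lead reshape r6 of the checked skeleton `Cruxes/CylinderRungTwo/Lines/killing_flux.lean` split the
vertical-gap step of the line into White's ε-regularity (registered stub `stub_epsilonRegularity`, the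
hypothesis of the theorem below: universal `ε, C, c, r₀ > 0` such that after one unit of smooth
`(1+ε)`-thin separating cylinder flow (a) the vertical component `ν₅` of the unit normal is `C`-Lipschitz
for the chordal distance at scale `r₀` and (b) `c r⁴ ≤ μH⁴(M_t ∩ B(F t x, r))` for `r ≤ r₀`) and the
ELEMENTARY implication proved here:

  `stub_tiltGap : EpsilonRegularity → VerticalGap`,

i.e. for a (possibly smaller) universal `ε > 0` the unit normal of a `(1+ε)`-thin separating time slice
`M_t` (one unit after the flow started) is nowhere horizontal, `ν t x 5 ≠ 0`.

## Proof

Put `r = min(r₀, 1/(2C))`, `V = μH⁴(S⁴)` and `ε = min(ε₁, c r⁴/(4V))`.  Suppose `ν₅(x₀) = 0` at time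
`t`.  With `μ = (F t)^* μH⁴` the induced area measure on `M`:

* FLUX (landed `Theorems.CylinderRungTwo.KillingFlux.stub_fluxIdentity`): `V = |∫ ν₅ dμ| ≤ ∫ |ν₅| dμ`;
* AREA (tree `measure_ratio_le_cylEntropy` and thinness): `μ(M) = μH⁴(M_t) ≤ (1+ε) V`;
* COST OF A ZERO: on `S = (F t)⁻¹(B(F t x₀, r))`, `|ν₅| = |ν₅ - ν₅(x₀)| ≤ C r ≤ 1/2` by (a), and
  `μ(S) = μH⁴(M_t ∩ B(F t x₀, r)) ≥ c r⁴` by (b);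
* hence `V ≤ ∫ |ν₅| ≤ μ(M) - μ(S)/2 ≤ (1+ε) V - c r⁴/2 ≤ V + c r⁴/4 - c r⁴/2 < V`, a contradiction.

Everything here is PROVED (no `sorry`, no new definitions, no named facts).
-/

noncomputable section

-- the prescribed namespace `Summit.SmoothPoincare4.SmoothPoincare4.…` repeats `SmoothPoincare4`
set_option linter.dupNamespace false

open MeasureTheory Set Filter
open scoped Manifold ContDiff ENNReal Topology BigOperators

namespace Summit.SmoothPoincare4.SmoothPoincare4.Cruxes.CylinderRungTwo.KillingFlux

open Literature.Geometry.Riemannian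
open Literature.Geometry.Lorentzian Literature.Geometry.Lorentzian.PseudoRiemannianMetric
open Literature.Geometry.Riemannian.SphericalCylinderEntropy (cylKernel cylDensity cylEntropy truncL
  measure_ratio_le_cylEntropy hausdorffMeasure_sphere_four_pos hausdorffMeasure_sphere_four_lt_top)
open Summit.SmoothPoincare4.SmoothPoincare4.Theorems.CylinderRungTwo.KillingFlux (stub_fluxIdentity
  measurableEmbedding_of_emb norm_nu)

/-- The integral bookkeeping of the tilt gap: on a finite measure space, a function with `|f| ≤ 1`
everywhere and `|f| ≤ 1/2` on a measurable set `S` has `∫ |f| ≤ μ(univ) - μ(S)/2`. [folklore] -/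
theorem integral_abs_le_measureReal_sub {X : Type*} [MeasurableSpace X] {μ : Measure X}
    [IsFiniteMeasure μ] {f : X → ℝ} (h1 : ∀ x, |f x| ≤ 1) {S : Set X} (hS : MeasurableSet S)
    (hS2 : ∀ x ∈ S, |f x| ≤ 1 / 2) :
    ∫ x, |f x| ∂μ ≤ μ.real Set.univ - 1 / 2 * μ.real S := by
  have hpt : ∀ x, |f x| ≤ 1 - 1 / 2 * S.indicator (1 : X → ℝ) x := by
    intro x
    by_cases hx : x ∈ S
    · rw [Set.indicator_of_mem hx, Pi.one_apply]
      linarith [hS2 x hx]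
    · rw [Set.indicator_of_notMem hx]
      linarith [h1 x]
  have hint1 : Integrable (S.indicator (1 : X → ℝ)) μ := (integrable_const 1).indicator hS
  have hint2 : Integrable (fun x => 1 - 1 / 2 * S.indicator (1 : X → ℝ) x) μ :=
    (integrable_const 1).sub (hint1.const_mul _)
  calc ∫ x, |f x| ∂μ ≤ ∫ x, (1 - 1 / 2 * S.indicator (1 : X → ℝ) x) ∂μ :=
        integral_mono_of_nonneg (Eventually.of_forall fun x => abs_nonneg _) hint2
          (Eventually.of_forall hpt)
    _ = μ.real Set.univ - 1 / 2 * μ.real S := by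
        rw [integral_sub (integrable_const 1) (hint1.const_mul _), integral_const, integral_const_mul,
          integral_indicator_one hS, smul_eq_mul, mul_one]

/-- **TILT GAP** (stub `stub_tiltGap` of line `killing-flux`, crux `CylinderEntropy.CylinderRungTwo`,
registered signature): White-type ε-regularity for thin cylinder flows (the hypothesis: universal
`ε, C, c, r₀ > 0` giving (a) `ν₅` is `C`-Lipschitz for the chordal distance at scale `r₀` and (b) the
lower area bound `c r⁴ ≤ μH⁴(M_t ∩ B(F t x, r))`, `r ≤ r₀`, on every `(1+ε)`-thin separating time slice
one unit after the start) implies the VERTICAL GAP: for a universal `ε > 0` the unit normal of such a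
time slice is nowhere horizontal.  Proof: with `r = min(r₀, 1/(2C))`, `V = μH⁴(S⁴)`,
`ε = min(ε₁, c r⁴/(4V))`, a zero `x₀` of `ν₅` gives, for the induced area measure `μ = (F t)^*μH⁴`,
`V = |∫ ν₅ dμ| ≤ ∫ |ν₅| dμ ≤ μ(M) - μ(S)/2 ≤ (1+ε)V - c r⁴/2 < V` (`S` the preimage of the ball
`B(F t x₀, r)`, where `|ν₅| ≤ C r ≤ 1/2`), using the landed flux identity and the tree's
`measure_ratio_le_cylEntropy`. [folklore] -/
theorem stub_tiltGap :
    (∃ ε : ℝ, 0 < ε ∧ ∃ C : ℝ, 0 < C ∧ ∃ c : ℝ, 0 < c ∧ ∃ r₀ : ℝ, 0 < r₀ ∧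
      ∀ (M : Type) [TopologicalSpace M] [T2Space M] [SecondCountableTopology M]
        [ChartedSpace (EuclideanSpace ℝ (Fin 4)) M] [IsManifold (𝓡 4) ∞ M] [CompactSpace M]
        [ConnectedSpace M]
        (F : ℝ → M → EuclideanSpace ℝ (Fin 6)) (ν : ℝ → M → EuclideanSpace ℝ (Fin 6)) (T : ℝ),
        IsCylinderMCF M F ν T →
        ∀ t : ℝ, T + 1 ≤ t →
          (∀ s ∈ Set.Icc (t - 1) t, SeparatesEnds (Set.range (F s))) →
          (∀ s ∈ Set.Icc (t - 1) t, cylEntropy (Set.range (F s)) < ENNReal.ofReal (1 + ε)) →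
          (∀ x y : M, ‖F t x - F t y‖ ≤ r₀ → |ν t x 5 - ν t y 5| ≤ C * ‖F t x - F t y‖) ∧
          (∀ x : M, ∀ r : ℝ, 0 < r → r ≤ r₀ →
            ENNReal.ofReal (c * r ^ 4) ≤
              μH[4] (Set.range (F t) ∩ Metric.ball (F t x) r))) →
    ∃ ε : ℝ, 0 < ε ∧
      ∀ (M : Type) [TopologicalSpace M] [T2Space M] [SecondCountableTopology M]
        [ChartedSpace (EuclideanSpace ℝ (Fin 4)) M] [IsManifold (𝓡 4) ∞ M] [CompactSpace M]
        [ConnectedSpace M]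
        (F : ℝ → M → EuclideanSpace ℝ (Fin 6)) (ν : ℝ → M → EuclideanSpace ℝ (Fin 6)) (T : ℝ),
        IsCylinderMCF M F ν T →
        ∀ t : ℝ, T + 1 ≤ t →
          (∀ s ∈ Set.Icc (t - 1) t, SeparatesEnds (Set.range (F s))) →
          (∀ s ∈ Set.Icc (t - 1) t, cylEntropy (Set.range (F s)) < ENNReal.ofReal (1 + ε)) →
          ∀ x : M, ν t x 5 ≠ 0 := by
  rintro ⟨ε₁, hε₁, C, hC, c, hc, r₀, hr₀, hreg⟩
  -- the universal constants `V = μH⁴(S⁴)`, `r = min(r₀, 1/(2C))`, `ε = min(ε₁, c r⁴/(4V))`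
  set V : ℝ := (μH[4] (Metric.sphere (0 : EuclideanSpace ℝ (Fin 5)) 1)).toReal with hV
  have hSne0 : μH[4] (Metric.sphere (0 : EuclideanSpace ℝ (Fin 5)) 1) ≠ 0 :=
    hausdorffMeasure_sphere_four_pos.ne'
  have hSnetop : μH[4] (Metric.sphere (0 : EuclideanSpace ℝ (Fin 5)) 1) ≠ ⊤ :=
    hausdorffMeasure_sphere_four_lt_top.ne
  have hVpos : 0 < V := ENNReal.toReal_pos hSne0 hSnetop
  set r : ℝ := min r₀ (1 / (2 * C)) with hr
  have hrpos : 0 < r := lt_min hr₀ (by positivity)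
  have hrr₀ : r ≤ r₀ := min_le_left _ _
  have hCr : C * r ≤ 1 / 2 := by
    calc C * r ≤ C * (1 / (2 * C)) := mul_le_mul_of_nonneg_left (min_le_right _ _) hC.le
      _ = 1 / 2 := by field_simp
  have hcr4 : 0 < c * r ^ 4 := by positivity
  refine ⟨min ε₁ (c * r ^ 4 / (4 * V)), lt_min hε₁ (by positivity), ?_⟩
  intro M _ _ _ _ _ _ _ F ν T hflow t ht hsep hthin x₀ hx₀
  set ε : ℝ := min ε₁ (c * r ^ 4 / (4 * V)) with hε
  have hεpos : 0 < ε := lt_min hε₁ (by positivity)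
  have hεε₁ : ε ≤ ε₁ := min_le_left _ _
  have hεV : ε * V ≤ c * r ^ 4 / 4 := by
    calc ε * V ≤ c * r ^ 4 / (4 * V) * V := mul_le_mul_of_nonneg_right (min_le_right _ _) hVpos.le
      _ = c * r ^ 4 / 4 := by field_simp
  -- ε-regularity at time `t`
  have hthin₁ : ∀ s ∈ Set.Icc (t - 1) t, cylEntropy (Set.range (F s)) < ENNReal.ofReal (1 + ε₁) :=
    fun s hs => lt_of_lt_of_le (hthin s hs) (ENNReal.ofReal_le_ofReal (by linarith))
  obtain ⟨hlip, harea⟩ := hreg M F ν T hflow t ht hsep hthin₁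
  -- the time-`t` slice: a smooth embedding into `N` with a continuous unit normal tangent to `N`
  have hTt : T ≤ t := by linarith
  have hι : Manifold.IsSmoothEmbedding (𝓡 4) (𝓡 6) ∞ (F t) := hflow.isSmoothEmbedding t hTt
  have hιN : ∀ x, ∑ i : Fin 5, F t x (Fin.castSucc i) ^ 2 = 1 := hflow.mem_cyl t hTt
  have hνc : Continuous (ν t) := (hflow.contMDiff_normal t hTt).continuous
  have hνn := hflow.isUnitNormal t hTt
  have hνt := hflow.normal_tangent t hTt
  have hιc : Continuous (F t) := hι.contMDiff.continuous
  obtain ⟨R, hR⟩ := hsep t ⟨by linarith, le_rfl⟩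
  letI : MeasurableSpace M := borel M
  haveI : BorelSpace M := ⟨rfl⟩
  have hme : MeasurableEmbedding (F t) := measurableEmbedding_of_emb hι
  -- FLUX: `|∫ ν₅ dμ| = V`
  have hflux := stub_fluxIdentity M (F t) hι hιN ⟨R, hR⟩ (ν t) hνc hνn hνt
  set μ : Measure M := Measure.comap (F t) (μH[4] : Measure (EuclideanSpace ℝ (Fin 6))) with hμ
  -- AREA: `μ(M) = μH⁴(M_t) ≤ (1+ε) V`
  have hthin_t : cylEntropy (Set.range (F t)) < ENNReal.ofReal (1 + ε) := hthin t ⟨by linarith, le_rfl⟩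
  obtain ⟨B, hB⟩ := (isCompact_range (continuous_abs.comp
    ((EuclideanSpace.proj (5 : Fin 6)).continuous.comp hιc))).bddAbove
  have hBr : ∀ z ∈ Set.range (F t), |z 5| ≤ B := by
    rintro _ ⟨y, rfl⟩
    exact hB ⟨y, rfl⟩
  have hratio := measure_ratio_le_cylEntropy hme.measurableSet_range
    (by rintro _ ⟨y, rfl⟩; exact hιN y) hBr
  have harea_le : μH[4] (Set.range (F t)) ≤
      μH[4] (Metric.sphere (0 : EuclideanSpace ℝ (Fin 5)) 1) * ENNReal.ofReal (1 + ε) :=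
    (ENNReal.inv_mul_le_iff hSne0 hSnetop).1 (hratio.trans hthin_t.le)
  have harea_lt_top : μH[4] (Set.range (F t)) < ⊤ :=
    lt_of_le_of_lt harea_le
      (ENNReal.mul_lt_top hausdorffMeasure_sphere_four_lt_top ENNReal.ofReal_lt_top)
  have huniv : μ Set.univ = μH[4] (Set.range (F t)) := by
    rw [hμ, hme.comap_apply, Set.image_univ]
  haveI : IsFiniteMeasure μ := ⟨by rw [huniv]; exact harea_lt_top⟩
  have huniv_real : μ.real Set.univ ≤ V + ε * V := by
    have h : (μH[4] (Metric.sphere (0 : EuclideanSpace ℝ (Fin 5)) 1) * ENNReal.ofReal (1 + ε)).toReal =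
        V + ε * V := by
      rw [ENNReal.toReal_mul, ENNReal.toReal_ofReal (by linarith), ← hV]
      ring
    rw [measureReal_def, huniv, ← h]
    exact ENNReal.toReal_mono (ENNReal.mul_ne_top hSnetop ENNReal.ofReal_ne_top) harea_le
  -- COST OF A ZERO: the ball `B(F t x₀, r)` has area `≥ c r⁴` and `|ν₅| ≤ 1/2` on it
  set S : Set M := F t ⁻¹' Metric.ball (F t x₀) r with hS
  have hSmeas : MeasurableSet S := (Metric.isOpen_ball.preimage hιc).measurableSet
  have hμS : ENNReal.ofReal (c * r ^ 4) ≤ μ S := by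
    rw [hμ, hme.comap_apply, hS, Set.image_preimage_eq_range_inter]
    exact harea x₀ r hrpos hrr₀
  have hS_real : c * r ^ 4 ≤ μ.real S := by
    rw [measureReal_def]
    exact (ENNReal.ofReal_le_iff_le_toReal (measure_ne_top μ S)).1 hμS
  have hsmall : ∀ y ∈ S, |ν t y 5| ≤ 1 / 2 := by
    intro y hy
    have hy' : ‖F t y - F t x₀‖ < r := by
      rwa [hS, Set.mem_preimage, Metric.mem_ball, dist_eq_norm] at hy
    have h1 := hlip y x₀ (by linarith)
    rw [hx₀, sub_zero] at h1
    calc |ν t y 5| ≤ C * ‖F t y - F t x₀‖ := h1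
      _ ≤ C * r := mul_le_mul_of_nonneg_left hy'.le hC.le
      _ ≤ 1 / 2 := hCr
  have hle1 : ∀ y, |ν t y 5| ≤ 1 := fun y => by
    have h := PiLp.norm_apply_le (ν t y) (5 : Fin 6)
    rw [norm_nu hνn y, Real.norm_eq_abs] at h
    exact h
  -- combine
  have hint_le := integral_abs_le_measureReal_sub (μ := μ) hle1 hSmeas hsmall
  have hfluxV : V ≤ ∫ y, |ν t y 5| ∂μ := by
    rw [hV, ← hflux]
    exact abs_integral_le_integral_abs
  linarith
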